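/-
Copyright (c) 2026 the pub-hodgecm-mathlib formalisation cell (harness21).  Prover seat hodgecm-mathlib-K2Liu-p03 (g5): Track B «K2-LIT»,
#184♮ = hLiu418 = stmt-HodgeConjecture-24832; Road Φ of socket #41, organ Φ3b (LEAD F0P6-plan (g11) ruling «M-155l» (3c)).
-/
import Summits.HodgeConjecture.HodgeConjecture.Theorems.K2LiuSiegelUnipotentSplitDefs   -- DEFS leaf 2: `unipDeltaSplit`
import Literature.NumberTheory.K2Lit.AdelicPlaceSplitting                               -- ★ `fstS ∕ sndS ∕ glueS ∕ splitMulEquiv ∕ continuous_glueS`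
import HarnessLib

/-!
# Crux `HLiu418`, Road Φ of socket #41, organ Φ3b — DEFS LEAF 3: the splitting of `N_Δ(𝔸)` AT A FINITE SET OF PLACES `S`
# `unipDeltaSplitAt S : N_Δ(𝔸) ≃ₜ* N_Δ(L⁺ ⊗ ℝ) × ((∏_{v∈S} N_Δ(L⁺_v)) × ∏'_{v∉S} [N_Δ(L⁺_v), K_{H,v} ∩ N_Δ(L⁺_v)])`

Cell `hodgecm-mathlib`, crux item hLiu418 = `stmt-HodgeConjecture-24832`, route of record `HCCMUnconditional`; squad K2 ∕ K2Liu, road `K2_Liu`,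
socket #41 `sig_K2LiuSiegelEisensteinContinuation`, Road Φ, organ Φ3b «`N_Δ(𝔸)` as a restricted product» (census
`K2/K2Liu-p03/g5/CENSUS-PHI3-PureTensorEuler…md` §1 row Φ3b).  DEFINITIONS WITH BODIES + their algebra (the cell's DEFS lane); no `instance`, no
`notation`, no named-fact hypothesis, no `sorry`; lane `--supports stmt-HodgeConjecture-24832`.

WHY A NAMED DEFINITION.  The pinned splitting of a Haar measure on `N_Δ(𝔸)` (next file, `K2LiuSiegelUnipotentHaarPinned`) and the Euler product (Φ3c)
push a measure along `u ↦ (u_∞, ((u_v)_{v∈S}, (u_v)_{v∉S}))`.  Composing ★ `unipDeltaSplit` with the generic ★ `PlaceSplitting.splitEquiv` INSIDE a proof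
(`ContinuousMulEquiv.trans ∕ prodCongr`) makes the unifier compare two instance paths on the restricted product of the nested subtypes
`↥N_Δ(L⁺_v) ≤ ↥H(L⁺_v)` and time out (MEASURED, `whnf` at 200 000 heartbeats); a NAMED isomorphism with a declared type avoids the comparison
altogether — the same device as DEFS leaf 2.

CONTENTS (namespace `…Cruxes.HLiu418.K2LiuSiegelUnipotentSplitAtDefs`).
* `isOpen_inH_unipDeltaLoc`, `fact_isOpen_inH_unipDeltaLoc` — `K_{H,v} ∩ N_Δ(L⁺_v)` is open in `N_Δ(L⁺_v)` (★ `isOpen_inH`, ★ `isOpen_localInt`); the `Fact`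
  keys the restricted product's topological-group structure (introduced by `haveI`, never an `instance`).
* `unipDeltaSplitAtFun ∕ Inv` with inverse, multiplicativity and continuity lemmas (★ `fstS ∕ sndS ∕ glueS`, ★ `continuous_glueS`), and
  **`unipDeltaSplitAt S`** assembled from them; coordinate lemmas `unipDeltaSplitAt_apply` (`rfl`) and `coe_unipDeltaSplitAt_symm_apply`.
[cite: BorelJacquet1979, §4.1] [cite: PlatonovRapinchuk1994, §5.1] [cite: Tan1999, §2]

HONEST LABEL.  Carriers only; `HC_CM` is proved only modulo the 7 printed citations (2 remaining named inputs: hLiu418 = 24832, h413 = 24833) until rung 0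
closes; this file is a helper (`--supports stmt-HodgeConjecture-24832`) and closes no socket by itself.

## References
* [BorelJacquet1979] A. Borel, H. Jacquet, PSPM 33.1 (1979), §4.1.
* [PlatonovRapinchuk1994] V. Platonov, A. Rapinchuk, *Algebraic Groups and Number Theory* (1994), §5.1.
* [Tan1999] V. Tan, Canad. J. Math. 51 (1999), §2.
-/

set_option autoImplicit false
-- the mandated namespace repeats the single-problem summit's segment (`HodgeConjecture.HodgeConjecture`)
set_option linter.dupNamespace false

noncomputable section

open scoped Matrix RestrictedProduct
open NumberField IsDedekindDomain

namespace Summit.HodgeConjecture.HodgeConjecture.Cruxes.HLiu418.K2LiuSiegelUnipotentSplitAtDefs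

open Literature.NumberTheory.Automorphic Literature.NumberTheory.GaloisRepresentations
open Literature.NumberTheory.GelbartRogawski1991 Literature.NumberTheory.GelbartRogawski1991.GRConstruction
open Literature.NumberTheory.K2Lit.SiegelDoubled
open Literature.NumberTheory.K2Lit.PlaceSplitting
open Literature.Topology.Algebra.RestrictedProduct (inH isOpen_inH)
open Summit.HodgeConjecture.HodgeConjecture.Cruxes.HLiu418.K2LiuSiegelUnipotentLocalDefs
open Summit.HodgeConjecture.HodgeConjecture.Cruxes.HLiu418.K2LiuSiegelUnipotentSplitDefs

variable (L : Type) [Field L] [NumberField L] [IsCMField L]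
variable {N M n : ℕ} (e : Fin N × Fin M ≃ Fin n)
  (dV : Fin N → L) (hdV : ∀ i, IsCMField.complexConj L (dV i) = dV i)
  (dW : Fin M → L) (hdW : ∀ i, IsCMField.complexConj L (dW i) = dW i)

/-! ## §1 `K_{H,v} ∩ N_Δ(L⁺_v)` is open in `N_Δ(L⁺_v)` -/

/-- `K_{H,v} ∩ N_Δ(L⁺_v)` is open in `N_Δ(L⁺_v)` (★ `isOpen_inH`, ★ `isOpen_localInt`). [cite: BorelJacquet1979, §4.1] -/
theorem isOpen_inH_unipDeltaLoc (v : HeightOneSpectrum (𝓞 (Fp L))) :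
    IsOpen (((inH (fun v => UnitaryGroup.localInt L (IsCMField.complexConj L) (n + n) (hermD L e dV hdV dW hdW) v) (fun v => unipDeltaLoc L e dV hdV dW hdW v) v) : Subgroup ↥(unipDeltaLoc L e dV hdV dW hdW v)) : Set ↥(unipDeltaLoc L e dV hdV dW hdW v)) :=
  isOpen_inH (fun v => UnitaryGroup.localInt L (IsCMField.complexConj L) (n + n) (hermD L e dV hdV dW hdW) v) (fun v => unipDeltaLoc L e dV hdV dW hdW v) (fun w => UnitaryGroup.isOpen_localInt L (IsCMField.complexConj L) (n + n) (hermD L e dV hdV dW hdW) w) v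

/-- the openness `Fact` for the family `(K_{H,v} ∩ N_Δ(L⁺_v))_v` — keys the restricted product's topological-group structure; introduced by `haveI` in proofs,
never declared as an instance. [cite: BorelJacquet1979, §4.1] -/
theorem fact_isOpen_inH_unipDeltaLoc :
    Fact (∀ v : HeightOneSpectrum (𝓞 (Fp L)), IsOpen (((inH (fun v => UnitaryGroup.localInt L (IsCMField.complexConj L) (n + n) (hermD L e dV hdV dW hdW) v) (fun v => unipDeltaLoc L e dV hdV dW hdW v) v) : Subgroup ↥(unipDeltaLoc L e dV hdV dW hdW v)) : Set ↥(unipDeltaLoc L e dV hdV dW hdW v))) :=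
  ⟨fun v => isOpen_inH_unipDeltaLoc L e dV hdV dW hdW v⟩

/-! ## §2 The splitting at `S` -/

section SplitAt

variable (S : Finset (HeightOneSpectrum (𝓞 (Fp L)))) [DecidableEq (HeightOneSpectrum (𝓞 (Fp L)))]

omit [DecidableEq (HeightOneSpectrum (𝓞 (Fp L)))] in
/-- the forward map `u ↦ (u_∞, ((u_v)_{v∈S}, (u_v)_{v∉S}))` (★ `unipDeltaSplit`, then ★ `fstS ∕ sndS` at `S`). [cite: BorelJacquet1979, §4.1] -/
def unipDeltaSplitAtFun (u : ↥(unipDelta L e dV hdV dW hdW)) : ↥(unipDeltaArch L e dV hdV dW hdW) × ((Π v : S, ↥(unipDeltaLoc L e dV hdV dW hdW v.1)) × (Πʳ v : {v : HeightOneSpectrum (𝓞 (Fp L)) // v ∉ S}, [↥(unipDeltaLoc L e dV hdV dW hdW v.1), inH (fun v => UnitaryGroup.localInt L (IsCMField.complexConj L) (n + n) (hermD L e dV hdV dW hdW) v) (fun v => unipDeltaLoc L e dV hdV dW hdW v) v.1])) :=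
  ((unipDeltaSplit L e dV hdV dW hdW u).1,
    (fstS (fun v => ↥(unipDeltaLoc L e dV hdV dW hdW v)) (fun v => inH (fun v => UnitaryGroup.localInt L (IsCMField.complexConj L) (n + n) (hermD L e dV hdV dW hdW) v) (fun v => unipDeltaLoc L e dV hdV dW hdW v) v) S (unipDeltaSplit L e dV hdV dW hdW u).2,
      sndS (fun v => ↥(unipDeltaLoc L e dV hdV dW hdW v)) (fun v => inH (fun v => UnitaryGroup.localInt L (IsCMField.complexConj L) (n + n) (hermD L e dV hdV dW hdW) v) (fun v => unipDeltaLoc L e dV hdV dW hdW v) v) S (unipDeltaSplit L e dV hdV dW hdW u).2))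

/-- the backward map `(a, (x, y)) ↦ unipDeltaSplit⁻¹ (a, glueS (x, y))`. [cite: BorelJacquet1979, §4.1] -/
def unipDeltaSplitAtInv (p : ↥(unipDeltaArch L e dV hdV dW hdW) × ((Π v : S, ↥(unipDeltaLoc L e dV hdV dW hdW v.1)) × (Πʳ v : {v : HeightOneSpectrum (𝓞 (Fp L)) // v ∉ S}, [↥(unipDeltaLoc L e dV hdV dW hdW v.1), inH (fun v => UnitaryGroup.localInt L (IsCMField.complexConj L) (n + n) (hermD L e dV hdV dW hdW) v) (fun v => unipDeltaLoc L e dV hdV dW hdW v) v.1]))) : ↥(unipDelta L e dV hdV dW hdW) :=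
  (unipDeltaSplit L e dV hdV dW hdW).symm (p.1, glueS (fun v => ↥(unipDeltaLoc L e dV hdV dW hdW v)) (fun v => inH (fun v => UnitaryGroup.localInt L (IsCMField.complexConj L) (n + n) (hermD L e dV hdV dW hdW) v) (fun v => unipDeltaLoc L e dV hdV dW hdW v) v) S p.2)

omit [DecidableEq (HeightOneSpectrum (𝓞 (Fp L)))] in
/-- `glueS (fstS x, sndS x) = x` (★ `splitMulEquiv`'s left inverse, restated without the equivalence). [cite: PlatonovRapinchuk1994, §5.1] -/
theorem glueS_fstS_sndS [DecidableEq (HeightOneSpectrum (𝓞 (Fp L)))] (x : (Πʳ v : HeightOneSpectrum (𝓞 (Fp L)), [↥(unipDeltaLoc L e dV hdV dW hdW v), inH (fun v => UnitaryGroup.localInt L (IsCMField.complexConj L) (n + n) (hermD L e dV hdV dW hdW) v) (fun v => unipDeltaLoc L e dV hdV dW hdW v) v])) :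
    glueS (fun v => ↥(unipDeltaLoc L e dV hdV dW hdW v)) (fun v => inH (fun v => UnitaryGroup.localInt L (IsCMField.complexConj L) (n + n) (hermD L e dV hdV dW hdW) v) (fun v => unipDeltaLoc L e dV hdV dW hdW v) v) S (fstS (fun v => ↥(unipDeltaLoc L e dV hdV dW hdW v)) (fun v => inH (fun v => UnitaryGroup.localInt L (IsCMField.complexConj L) (n + n) (hermD L e dV hdV dW hdW) v) (fun v => unipDeltaLoc L e dV hdV dW hdW v) v) S x, sndS (fun v => ↥(unipDeltaLoc L e dV hdV dW hdW v)) (fun v => inH (fun v => UnitaryGroup.localInt L (IsCMField.complexConj L) (n + n) (hermD L e dV hdV dW hdW) v) (fun v => unipDeltaLoc L e dV hdV dW hdW v) v) S x) = x :=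
  (splitMulEquiv (fun v => ↥(unipDeltaLoc L e dV hdV dW hdW v)) (fun v => inH (fun v => UnitaryGroup.localInt L (IsCMField.complexConj L) (n + n) (hermD L e dV hdV dW hdW) v) (fun v => unipDeltaLoc L e dV hdV dW hdW v) v) S).symm_apply_apply x

/-- `unipDeltaSplitAtInv ∘ unipDeltaSplitAtFun = id`. [cite: BorelJacquet1979, §4.1] -/
theorem unipDeltaSplitAtInv_fun (u : ↥(unipDelta L e dV hdV dW hdW)) :
    unipDeltaSplitAtInv L e dV hdV dW hdW S (unipDeltaSplitAtFun L e dV hdV dW hdW S u) = u := by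
  unfold unipDeltaSplitAtInv unipDeltaSplitAtFun
  dsimp only
  rw [glueS_fstS_sndS]
  exact (unipDeltaSplit L e dV hdV dW hdW).symm_apply_apply u

/-- `unipDeltaSplitAtFun ∘ unipDeltaSplitAtInv = id`. [cite: BorelJacquet1979, §4.1] -/
theorem unipDeltaSplitAtFun_inv (p : ↥(unipDeltaArch L e dV hdV dW hdW) × ((Π v : S, ↥(unipDeltaLoc L e dV hdV dW hdW v.1)) × (Πʳ v : {v : HeightOneSpectrum (𝓞 (Fp L)) // v ∉ S}, [↥(unipDeltaLoc L e dV hdV dW hdW v.1), inH (fun v => UnitaryGroup.localInt L (IsCMField.complexConj L) (n + n) (hermD L e dV hdV dW hdW) v) (fun v => unipDeltaLoc L e dV hdV dW hdW v) v.1]))) :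
    unipDeltaSplitAtFun L e dV hdV dW hdW S (unipDeltaSplitAtInv L e dV hdV dW hdW S p) = p := by
  unfold unipDeltaSplitAtInv unipDeltaSplitAtFun
  rw [ContinuousMulEquiv.apply_symm_apply]
  exact Prod.ext rfl ((splitMulEquiv (fun v => ↥(unipDeltaLoc L e dV hdV dW hdW v)) (fun v => inH (fun v => UnitaryGroup.localInt L (IsCMField.complexConj L) (n + n) (hermD L e dV hdV dW hdW) v) (fun v => unipDeltaLoc L e dV hdV dW hdW v) v) S).apply_symm_apply p.2)

omit [DecidableEq (HeightOneSpectrum (𝓞 (Fp L)))] in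
set_option maxHeartbeats 1600000 in -- MEASURED (fails at 200000, passes at 1600000): `isDefEq` on the `Prod`∕restricted-product `Mul` instances of the nested subtypes; plain `show`∕`rw`, no search tactics
/-- `unipDeltaSplitAtFun` is multiplicative. [cite: BorelJacquet1979, §4.1] -/
theorem unipDeltaSplitAtFun_mul (u u' : ↥(unipDelta L e dV hdV dW hdW)) :
    unipDeltaSplitAtFun L e dV hdV dW hdW S (u * u') =
      unipDeltaSplitAtFun L e dV hdV dW hdW S u * unipDeltaSplitAtFun L e dV hdV dW hdW S u' := by
  have h : unipDeltaSplit L e dV hdV dW hdW (u * u') = unipDeltaSplit L e dV hdV dW hdW u * unipDeltaSplit L e dV hdV dW hdW u' :=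
    map_mul _ u u'
  unfold unipDeltaSplitAtFun
  have h1 : (unipDeltaSplit L e dV hdV dW hdW (u * u')).1 =
      (unipDeltaSplit L e dV hdV dW hdW u).1 * (unipDeltaSplit L e dV hdV dW hdW u').1 := by
    have h' := congrArg Prod.fst h
    rwa [Prod.fst_mul] at h'
  have h2 : (unipDeltaSplit L e dV hdV dW hdW (u * u')).2 =
      (unipDeltaSplit L e dV hdV dW hdW u).2 * (unipDeltaSplit L e dV hdV dW hdW u').2 := by
    have h' := congrArg Prod.snd h
    rwa [Prod.snd_mul] at h'
  show (_, (_, _)) =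
    ((unipDeltaSplit L e dV hdV dW hdW u).1 * (unipDeltaSplit L e dV hdV dW hdW u').1,
      (fstS (fun v => ↥(unipDeltaLoc L e dV hdV dW hdW v)) (fun v => inH (fun v => UnitaryGroup.localInt L (IsCMField.complexConj L) (n + n) (hermD L e dV hdV dW hdW) v) (fun v => unipDeltaLoc L e dV hdV dW hdW v) v) S (unipDeltaSplit L e dV hdV dW hdW u).2 * fstS (fun v => ↥(unipDeltaLoc L e dV hdV dW hdW v)) (fun v => inH (fun v => UnitaryGroup.localInt L (IsCMField.complexConj L) (n + n) (hermD L e dV hdV dW hdW) v) (fun v => unipDeltaLoc L e dV hdV dW hdW v) v) S (unipDeltaSplit L e dV hdV dW hdW u').2,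
        sndS (fun v => ↥(unipDeltaLoc L e dV hdV dW hdW v)) (fun v => inH (fun v => UnitaryGroup.localInt L (IsCMField.complexConj L) (n + n) (hermD L e dV hdV dW hdW) v) (fun v => unipDeltaLoc L e dV hdV dW hdW v) v) S (unipDeltaSplit L e dV hdV dW hdW u).2 * sndS (fun v => ↥(unipDeltaLoc L e dV hdV dW hdW v)) (fun v => inH (fun v => UnitaryGroup.localInt L (IsCMField.complexConj L) (n + n) (hermD L e dV hdV dW hdW) v) (fun v => unipDeltaLoc L e dV hdV dW hdW v) v) S (unipDeltaSplit L e dV hdV dW hdW u').2))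
  rw [h1, h2]
  rfl

omit [DecidableEq (HeightOneSpectrum (𝓞 (Fp L)))] in
/-- `unipDeltaSplitAtFun` is continuous (★ `continuous_fstS`, ★ `continuous_sndS`). [cite: BorelJacquet1979, §4.1] -/
theorem continuous_unipDeltaSplitAtFun : Continuous (unipDeltaSplitAtFun L e dV hdV dW hdW S) :=
  (continuous_fst.comp (unipDeltaSplit L e dV hdV dW hdW).continuous).prodMk
    (((continuous_fstS (fun v => ↥(unipDeltaLoc L e dV hdV dW hdW v)) (fun v => inH (fun v => UnitaryGroup.localInt L (IsCMField.complexConj L) (n + n) (hermD L e dV hdV dW hdW) v) (fun v => unipDeltaLoc L e dV hdV dW hdW v) v) S).comp (continuous_snd.comp (unipDeltaSplit L e dV hdV dW hdW).continuous)).prodMk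
      ((continuous_sndS (fun v => ↥(unipDeltaLoc L e dV hdV dW hdW v)) (fun v => inH (fun v => UnitaryGroup.localInt L (IsCMField.complexConj L) (n + n) (hermD L e dV hdV dW hdW) v) (fun v => unipDeltaLoc L e dV hdV dW hdW v) v) S).comp (continuous_snd.comp (unipDeltaSplit L e dV hdV dW hdW).continuous)))

/-- `unipDeltaSplitAtInv` is continuous (★ `continuous_glueS`, keyed by `fact_isOpen_inH_unipDeltaLoc`). [cite: BorelJacquet1979, §4.1] [cite: PlatonovRapinchuk1994, §5.1] -/
theorem continuous_unipDeltaSplitAtInv : Continuous (unipDeltaSplitAtInv L e dV hdV dW hdW S) := by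
  haveI := fact_isOpen_inH_unipDeltaLoc L e dV hdV dW hdW
  exact (unipDeltaSplit L e dV hdV dW hdW).symm.continuous.comp
    (continuous_fst.prodMk ((continuous_glueS (fun v => ↥(unipDeltaLoc L e dV hdV dW hdW v)) (fun v => inH (fun v => UnitaryGroup.localInt L (IsCMField.complexConj L) (n + n) (hermD L e dV hdV dW hdW) v) (fun v => unipDeltaLoc L e dV hdV dW hdW v) v) S).comp continuous_snd))

/-- **THE SPLITTING OF `N_Δ(𝔸)` AT `S`**: `u ↦ (u_∞, ((u_v)_{v∈S}, (u_v)_{v∉S}))` is an isomorphism of topological groups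
`N_Δ(𝔸) ≃ₜ* N_Δ(L⁺ ⊗ ℝ) × ((∏_{v∈S} N_Δ(L⁺_v)) × ∏'_{v∉S} [N_Δ(L⁺_v), K_{H,v} ∩ N_Δ(L⁺_v)])` (★ `unipDeltaSplit` followed by the splitting of the restricted
product at `S`, ★ `fstS ∕ sndS ∕ glueS`). [cite: BorelJacquet1979, §4.1] [cite: PlatonovRapinchuk1994, §5.1] [cite: Tan1999, §2] -/
def unipDeltaSplitAt : ↥(unipDelta L e dV hdV dW hdW) ≃ₜ* ↥(unipDeltaArch L e dV hdV dW hdW) × ((Π v : S, ↥(unipDeltaLoc L e dV hdV dW hdW v.1)) × (Πʳ v : {v : HeightOneSpectrum (𝓞 (Fp L)) // v ∉ S}, [↥(unipDeltaLoc L e dV hdV dW hdW v.1), inH (fun v => UnitaryGroup.localInt L (IsCMField.complexConj L) (n + n) (hermD L e dV hdV dW hdW) v) (fun v => unipDeltaLoc L e dV hdV dW hdW v) v.1])) where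
  toFun := unipDeltaSplitAtFun L e dV hdV dW hdW S
  invFun := unipDeltaSplitAtInv L e dV hdV dW hdW S
  left_inv := unipDeltaSplitAtInv_fun L e dV hdV dW hdW S
  right_inv := unipDeltaSplitAtFun_inv L e dV hdV dW hdW S
  map_mul' := unipDeltaSplitAtFun_mul L e dV hdV dW hdW S
  continuous_toFun := continuous_unipDeltaSplitAtFun L e dV hdV dW hdW S
  continuous_invFun := continuous_unipDeltaSplitAtInv L e dV hdV dW hdW S

/-- `unipDeltaSplitAt S u = (u_∞, ((u_v)_{v∈S}, (u_v)_{v∉S}))` (definitional). [cite: BorelJacquet1979, §4.1] -/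
theorem unipDeltaSplitAt_apply (u : ↥(unipDelta L e dV hdV dW hdW)) :
    unipDeltaSplitAt L e dV hdV dW hdW S u =
      ((unipDeltaSplit L e dV hdV dW hdW u).1,
        (fstS (fun v => ↥(unipDeltaLoc L e dV hdV dW hdW v)) (fun v => inH (fun v => UnitaryGroup.localInt L (IsCMField.complexConj L) (n + n) (hermD L e dV hdV dW hdW) v) (fun v => unipDeltaLoc L e dV hdV dW hdW v) v) S (unipDeltaSplit L e dV hdV dW hdW u).2,
          sndS (fun v => ↥(unipDeltaLoc L e dV hdV dW hdW v)) (fun v => inH (fun v => UnitaryGroup.localInt L (IsCMField.complexConj L) (n + n) (hermD L e dV hdV dW hdW) v) (fun v => unipDeltaLoc L e dV hdV dW hdW v) v) S (unipDeltaSplit L e dV hdV dW hdW u).2)) :=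
  rfl

/-- `(unipDeltaSplitAt S)⁻¹ (a, (x, y)) = unipDeltaSplit⁻¹ (a, glueS (x, y))` (definitional). [cite: BorelJacquet1979, §4.1] -/
theorem unipDeltaSplitAt_symm_apply (p : ↥(unipDeltaArch L e dV hdV dW hdW) × ((Π v : S, ↥(unipDeltaLoc L e dV hdV dW hdW v.1)) × (Πʳ v : {v : HeightOneSpectrum (𝓞 (Fp L)) // v ∉ S}, [↥(unipDeltaLoc L e dV hdV dW hdW v.1), inH (fun v => UnitaryGroup.localInt L (IsCMField.complexConj L) (n + n) (hermD L e dV hdV dW hdW) v) (fun v => unipDeltaLoc L e dV hdV dW hdW v) v.1]))) :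
    (unipDeltaSplitAt L e dV hdV dW hdW S).symm p = (unipDeltaSplit L e dV hdV dW hdW).symm (p.1, glueS (fun v => ↥(unipDeltaLoc L e dV hdV dW hdW v)) (fun v => inH (fun v => UnitaryGroup.localInt L (IsCMField.complexConj L) (n + n) (hermD L e dV hdV dW hdW) v) (fun v => unipDeltaLoc L e dV hdV dW hdW v) v) S p.2) :=
  rfl

end SplitAt

end Summit.HodgeConjecture.HodgeConjecture.Cruxes.HLiu418.K2LiuSiegelUnipotentSplitAtDefs

end
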